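import Mathlib
import HarnessLib

/-!
# `CageBudgetFekete.UnboundedHeatVariance`, line `Sketch` — the Chebyshev sandwich on the circle

Support file (`--supports stmt-AtomisticToContinuum-15771`) proving the registered stub
`stub_chebyshevSandwich` (S_A) of line `Sketch`: for a kernel `Δ : ℤ → ℝ` that is summable against
`1 + x²` and every `k : ℝ`,

  `∑_x (1 − cos(kx)) Δ(x) ≤ (1 − cos k) · ∑_x x² · max(Δ(x), 0)`.

Pure real analysis. Termwise `0 ≤ 1 − cos(kx) ≤ x²(1 − cos k)` for integer `x` (the lattice Fejér
inequality `|sin(x φ)| ≤ |x|·|sin φ|`, by induction on `|x|` and the addition formula, combined with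
`1 − cos(2w) = 2 sin² w`), times `Δ(x) ≤ max(Δ(x), 0)` with both factors nonnegative; the two series
are dominated by `2(1+x²)|Δ x|` resp. `(1+x²)|Δ x|`, so `Summable.tsum_le_tsum` and `tsum_mul_left`
finish. The hypothesis `cos k ≠ 1` of the registered signature is not needed.
-/

namespace Summit.AtomisticToContinuum.FouriersLaw.Theorems.UnboundedHeatVariance.Sketch

/-- `|sin(n φ)| ≤ n·|sin φ|` for every natural `n` (induction, addition formula). [folklore] -/
private theorem abs_sin_nat_mul_le (n : ℕ) (φ : ℝ) : |Real.sin (n * φ)| ≤ n * |Real.sin φ| := by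
  -- adapted from Summits/AtomisticToContinuum/FouriersLaw/Cruxes/CornerNoDip/Lines/heatprofile.lean
  induction n with
  | zero => simp
  | succ n ih =>
    have e : ((n + 1 : ℕ) : ℝ) * φ = n * φ + φ := by push_cast; ring
    rw [e, Real.sin_add]
    have h1 : |Real.sin (n * φ) * Real.cos φ| ≤ |Real.sin (n * φ)| := by
      rw [abs_mul]
      exact mul_le_of_le_one_right (abs_nonneg _) (Real.abs_cos_le_one _)
    have h2 : |Real.cos (n * φ) * Real.sin φ| ≤ |Real.sin φ| := by
      rw [abs_mul]
      exact mul_le_of_le_one_left (abs_nonneg _) (Real.abs_cos_le_one _)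
    calc |Real.sin (n * φ) * Real.cos φ + Real.cos (n * φ) * Real.sin φ|
        ≤ |Real.sin (n * φ) * Real.cos φ| + |Real.cos (n * φ) * Real.sin φ| := abs_add_le _ _
      _ ≤ n * |Real.sin φ| + |Real.sin φ| := add_le_add (h1.trans ih) h2
      _ = ((n + 1 : ℕ) : ℝ) * |Real.sin φ| := by push_cast; ring

/-- `|sin(x φ)| ≤ |x|·|sin φ|` for every integer `x` — the lattice Fejér inequality. [folklore] -/
private theorem abs_sin_int_mul_le (x : ℤ) (φ : ℝ) :
    |Real.sin (x * φ)| ≤ |(x : ℝ)| * |Real.sin φ| := by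
  -- adapted from Summits/AtomisticToContinuum/FouriersLaw/Cruxes/CornerNoDip/Lines/heatprofile.lean
  obtain ⟨n, rfl | rfl⟩ := Int.eq_nat_or_neg x
  · simpa using abs_sin_nat_mul_le n φ
  · have e : ((-(n : ℤ) : ℤ) : ℝ) * φ = -((n : ℝ) * φ) := by push_cast; ring
    rw [e, Real.sin_neg, abs_neg]
    simpa using abs_sin_nat_mul_le n φ

/-- `1 − cos(k x) ≤ x²(1 − cos k)` for integer `x`: the Fejér weight `(1 − cos kx)/(2 − 2cos k)` is
at most `x²/2`, with equality at `x = ±1`. [folklore] -/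
private theorem one_sub_cos_mul_int_le (x : ℤ) (k : ℝ) :
    1 - Real.cos (k * (x : ℝ)) ≤ (x : ℝ) ^ 2 * (1 - Real.cos k) := by
  -- adapted from Summits/AtomisticToContinuum/FouriersLaw/Cruxes/CornerNoDip/Lines/heatprofile.lean
  have e1 : 1 - Real.cos (k * (x : ℝ)) = 2 * Real.sin (x * (k / 2)) ^ 2 := by
    rw [Real.sin_sq_eq_half_sub]
    have : 2 * (x * (k / 2)) = k * (x : ℝ) := by ring
    rw [this]; ring
  have e2 : 1 - Real.cos k = 2 * Real.sin (k / 2) ^ 2 := by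
    rw [Real.sin_sq_eq_half_sub]
    have : 2 * (k / 2) = k := by ring
    rw [this]; ring
  rw [e1, e2]
  have h := abs_sin_int_mul_le x (k / 2)
  have h2 : Real.sin (x * (k / 2)) ^ 2 ≤ (|(x : ℝ)| * |Real.sin (k / 2)|) ^ 2 := by
    rw [← sq_abs (Real.sin (x * (k / 2)))]
    exact pow_le_pow_left₀ (abs_nonneg _) h 2
  rw [mul_pow, sq_abs, sq_abs] at h2
  nlinarith [h2]

/-- **S_A — `stub_chebyshevSandwich` (Chebyshev comparison on the circle).** For a sequence
`Δ : ℤ → ℝ` with `Σ(1+x²)|Δ x| < ∞` and any `k` (with `cos k ≠ 1`, unused):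
`Σ_x (1 − cos(kx))Δ(x) ≤ (1 − cos k)·Σ_x x²·max(Δ x, 0)` — from `0 ≤ 1 − cos(kx) ≤ x²(1 − cos k)` for
integer `x` and `Δ x ≤ max(Δ x, 0)`, summed termwise. [folklore] -/
theorem stub_chebyshevSandwich :
    ∀ Δ : ℤ → ℝ, Summable (fun x : ℤ => (1 + (x : ℝ) ^ 2) * |Δ x|) → ∀ k : ℝ, Real.cos k ≠ 1 → ∑' x : ℤ, (1 - Real.cos (k * (x : ℝ))) * Δ x ≤ (1 - Real.cos k) * ∑' x : ℤ, (x : ℝ) ^ 2 * max (Δ x) 0 := by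
  intro Δ hΔ k _
  -- pointwise facts
  have hc0 : ∀ x : ℤ, 0 ≤ 1 - Real.cos (k * (x : ℝ)) := fun x => by
    linarith [Real.cos_le_one (k * (x : ℝ))]
  have hc2 : ∀ x : ℤ, 1 - Real.cos (k * (x : ℝ)) ≤ 2 := fun x => by
    linarith [Real.neg_one_le_cos (k * (x : ℝ))]
  have hm0 : ∀ x : ℤ, 0 ≤ max (Δ x) 0 := fun x => le_max_right _ _
  have hmle : ∀ x : ℤ, max (Δ x) 0 ≤ |Δ x| := fun x => max_le (le_abs_self _) (abs_nonneg _)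
  have hx2le : ∀ x : ℤ, (x : ℝ) ^ 2 ≤ 1 + (x : ℝ) ^ 2 := fun x => by linarith
  have h1le : ∀ x : ℤ, (1 : ℝ) ≤ 1 + (x : ℝ) ^ 2 := fun x => by nlinarith [sq_nonneg (x : ℝ)]
  -- termwise domination
  have hpt : ∀ x : ℤ, (1 - Real.cos (k * (x : ℝ))) * Δ x ≤
      (1 - Real.cos k) * ((x : ℝ) ^ 2 * max (Δ x) 0) := by
    intro x
    calc (1 - Real.cos (k * (x : ℝ))) * Δ x ≤ (1 - Real.cos (k * (x : ℝ))) * max (Δ x) 0 :=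
          mul_le_mul_of_nonneg_left (le_max_left _ _) (hc0 x)
      _ ≤ (x : ℝ) ^ 2 * (1 - Real.cos k) * max (Δ x) 0 :=
          mul_le_mul_of_nonneg_right (one_sub_cos_mul_int_le x k) (hm0 x)
      _ = (1 - Real.cos k) * ((x : ℝ) ^ 2 * max (Δ x) 0) := by ring
  -- summability of both sides
  have hsL : Summable fun x : ℤ => (1 - Real.cos (k * (x : ℝ))) * Δ x := by
    refine Summable.of_norm_bounded (hΔ.mul_left 2) (fun x => ?_)
    rw [Real.norm_eq_abs, abs_mul, abs_of_nonneg (hc0 x)]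
    calc (1 - Real.cos (k * (x : ℝ))) * |Δ x| ≤ 2 * |Δ x| :=
          mul_le_mul_of_nonneg_right (hc2 x) (abs_nonneg _)
      _ = 2 * (1 * |Δ x|) := by ring
      _ ≤ 2 * ((1 + (x : ℝ) ^ 2) * |Δ x|) :=
          mul_le_mul_of_nonneg_left (mul_le_mul_of_nonneg_right (h1le x) (abs_nonneg _))
            (by norm_num)
  have hsR : Summable fun x : ℤ => (x : ℝ) ^ 2 * max (Δ x) 0 :=
    Summable.of_nonneg_of_le (fun x => mul_nonneg (sq_nonneg _) (hm0 x))
      (fun x => mul_le_mul (hx2le x) (hmle x) (hm0 x) (by positivity)) hΔ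
  -- sum and pull out the constant
  calc ∑' x : ℤ, (1 - Real.cos (k * (x : ℝ))) * Δ x
      ≤ ∑' x : ℤ, (1 - Real.cos k) * ((x : ℝ) ^ 2 * max (Δ x) 0) :=
        Summable.tsum_le_tsum hpt hsL (hsR.mul_left _)
    _ = (1 - Real.cos k) * ∑' x : ℤ, (x : ℝ) ^ 2 * max (Δ x) 0 := tsum_mul_left

end Summit.AtomisticToContinuum.FouriersLaw.Theorems.UnboundedHeatVariance.Sketch
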